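/-
Copyright (c) 2026 the pub-hodgecm-mathlib formalisation cell (harness21).  Prover seat hodgecm-mathlib-LH4-p12 (g4), Track A «(D-RAM) FOUR-FRAME», unit U2H, the census leaf
(ρ2b′-X) `stub_U2H_fixedPointCensus_typeTwo_unit0` — seam (α) «INDICATOR → RANGE» of socket (C) (LH4-p10 (g3) reader line #7): the order filtration in `j` is monotone and cut off
at the conductor level `jl` of `lam`.  2026-09-04.
-/
import Summits.HodgeConjecture.HodgeConjecture.Theorems.F0P3cDyRamWSideOrderCensus   -- ★ p857271 (W1)–(W4); brings ★ DEFS leaf p857239 (`IsOrd`) and ★ `QuadraticOrderIntegralBasis` (`mem_order_mono`)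
import HarnessLib

/-!
# Crux `H413`, line LH4 «(D-RAM) FOUR-FRAME», leaf (ρ2b′-X) — the ORDER FILTRATION IN THE CONDUCTOR EXPONENT: `lam ∈ 𝒪_j ⟺ j ≤ jl`, and the census sums
# `Σ_{j ≤ J} [lam ∈ 𝒪_j]·F j` collapse to `Σ_{j ≤ jl} F j`

Cell `hodgecm-mathlib` (D-0151), FLOOR 0, crux H413 = `stmt-HodgeConjecture-24833`, unit U2H, leaf (ρ2b′-X) (OPEN-CONFIRMED, T18-55).  THEOREMS ONLY (no `def`, no instance, no notation,
no `sorry`); lane `--supports stmt-HodgeConjecture-24833 --as helper` (count-neutral).  WHY (socket (C), reader line #7 seam (α)): the block census in M-letters (★ W4 p857271 axis, ★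
p857411 cone, LH4-p11 (g5) (C1)) is summed over `j ∈ range (J+1)` against the INDICATOR `[IsOrd ρ α (jE ϖ ^ j) lam]` with `hJ : lam ∉ 𝒪_{J+1}`, while the toric tables T5a∕b∕c and the
sum T5s (★ p857350 ∕ ★ p857467) run over `j ∈ range (jl+1)` with NO indicator, `jl` = the conductor level of `lam` (`|lam − ρ lam| = |ϖE|^{jl}·|α − ρα|`).  This file is the
two-lemma dictionary between the two: the orders `𝒪_j = 𝒪_{ϖE^j}` DECREASE in `j` (`isOrd_pow_of_le`), `lam ∈ 𝒪_j ⟺ j ≤ jl` (`isOrd_pow_iff_le`), hence `lam ∉ 𝒪_{jl+1}` (the `hJ` of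
the census files at `J := jl`) and `Σ_{j ∈ range (J+1)} (if lam ∈ 𝒪_j then F j else 0) = Σ_{j ∈ range (jl+1)} F j` for every `J ≥ jl` (`sum_range_ite_isOrd_eq_sum_range`).
HONEST LABEL: count-neutral; HC_CM is proved only modulo the 7 printed citations (2 remaining named inputs: hLiu418 = `stmt-HodgeConjecture-24832`, h413 = `stmt-HodgeConjecture-24833`) until
rung 0 closes.

## References
* [Flicker1998UnitaryFL] Y. Z. Flicker, *Elementary proof of a fundamental lemma for a unitary group*, Canad. J. Math. 50 (1998), p. 84 REMARK (the orders `R_j` and their filtration).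
* [Kottwitz1986BaseChangeUnits] R. E. Kottwitz, *Base change for unit elements of Hecke algebras*, Compositio Math. 60 (1986), §1 pp. 240–241.
-/

set_option autoImplicit false

noncomputable section

open scoped Valued WithZero
open WithZero
open scoped Classical
open Literature.NumberTheory.LocalFields.QuadraticOrder
open Summit.HodgeConjecture.HodgeConjecture.Cruxes.H413.F0P3cDyRamToricCensusDefs

namespace Summit.HodgeConjecture.HodgeConjecture.Cruxes.H413.F0P3cDyRamOrderFiltrationRange

variable {K : Type*} [Field K] [Valued K ℤᵐ⁰] {ρ : K →+* K} {α : K}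

/-- **The orders decrease in the conductor exponent**: `𝒪_{ϖE^j} ⊆ 𝒪_{ϖE^i}` for `i ≤ j` (`|ϖE| ≤ 1`). [cite: Flicker1998UnitaryFL, p. 84 REMARK] -/
theorem isOrd_pow_of_le {ϖE : K} (hϖ1 : Valued.v ϖE ≤ 1) {i j : ℕ} (hij : i ≤ j) {z : K} (hz : IsOrd ρ α (ϖE ^ j) z) : IsOrd ρ α (ϖE ^ i) z := by
  refine mem_order_mono ?_ hz
  rw [map_pow, map_pow]
  exact pow_le_pow_right_of_le_one' hϖ1 hij

/-- **`lam ∈ 𝒪_j ⟺ j ≤ jl`** for an integral `lam` of CONDUCTOR LEVEL `jl` (`|lam − ρ lam| = |ϖE|^{jl}·|α − ρα|`; `0 < |ϖE| < 1`, `ρα ≠ α`). [cite: Flicker1998UnitaryFL, p. 84 REMARK] -/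
theorem isOrd_pow_iff_le (hα : ρ α ≠ α) {ϖE : K} (hϖ0 : ϖE ≠ 0) (hϖ1 : Valued.v ϖE < 1) {lam : K} (hlam1 : Valued.v lam ≤ 1) {jl : ℕ}
    (hjl : Valued.v (lam - ρ lam) = Valued.v ϖE ^ jl * Valued.v (α - ρ α)) (j : ℕ) : IsOrd ρ α (ϖE ^ j) lam ↔ j ≤ jl := by
  have hd : 0 < Valued.v (α - ρ α) := zero_lt_iff.2 ((Valuation.ne_zero_iff _).2 (sub_ne_zero.2 (Ne.symm hα)))
  have hϖpos : 0 < Valued.v ϖE := zero_lt_iff.2 ((Valuation.ne_zero_iff _).2 hϖ0)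
  rw [isOrd_iff, and_iff_right hlam1, hjl, Valuation.map_mul, Valuation.map_pow, mul_le_mul_iff_of_pos_right hd]
  exact pow_le_pow_iff_right_of_lt_one₀ hϖpos hϖ1

/-- Hence **`lam ∉ 𝒪_{jl+1}`** — the `hJ` binder of the census files at `J := jl`. [cite: Flicker1998UnitaryFL, p. 84 REMARK] -/
theorem not_isOrd_pow_condLevel_succ (hα : ρ α ≠ α) {ϖE : K} (hϖ0 : ϖE ≠ 0) (hϖ1 : Valued.v ϖE < 1) {lam : K} (hlam1 : Valued.v lam ≤ 1) {jl : ℕ}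
    (hjl : Valued.v (lam - ρ lam) = Valued.v ϖE ^ jl * Valued.v (α - ρ α)) : ¬ IsOrd ρ α (ϖE ^ (jl + 1)) lam := by
  rw [isOrd_pow_iff_le hα hϖ0 hϖ1 hlam1 hjl]
  omega

/-- **INDICATOR → RANGE**: if `lam ∈ 𝒪_j ⟺ j ≤ jl` then for every `J ≥ jl`, `Σ_{j ∈ range (J+1)} (if lam ∈ 𝒪_j then F j else 0) = Σ_{j ∈ range (jl+1)} F j`.
[cite: Kottwitz1986BaseChangeUnits, §1 pp. 240–241] -/
theorem sum_range_ite_isOrd_eq_sum_range {N : Type*} [AddCommMonoid N] {ϖE lam : K} {jl : ℕ} (hiff : ∀ j, IsOrd ρ α (ϖE ^ j) lam ↔ j ≤ jl)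
    {J : ℕ} (hJ : jl ≤ J) (F : ℕ → N) :
    ∑ j ∈ Finset.range (J + 1), (if IsOrd ρ α (ϖE ^ j) lam then F j else 0) = ∑ j ∈ Finset.range (jl + 1), F j := by
  rw [← Finset.sum_filter]
  refine Finset.sum_congr ?_ fun _ _ => rfl
  ext j
  simp only [Finset.mem_filter, Finset.mem_range, hiff]
  omega

/-- The same with the conductor level read from `|lam − ρ lam|` and ANY admissible cut-off `J` (`lam ∉ 𝒪_{J+1}` ⇒ `jl ≤ J`). [cite: Kottwitz1986BaseChangeUnits, §1 pp. 240–241] -/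
theorem sum_range_ite_isOrd_eq_sum_range_of_condLevel {N : Type*} [AddCommMonoid N] (hα : ρ α ≠ α) {ϖE : K} (hϖ0 : ϖE ≠ 0) (hϖ1 : Valued.v ϖE < 1)
    {lam : K} (hlam1 : Valued.v lam ≤ 1) {jl : ℕ} (hjl : Valued.v (lam - ρ lam) = Valued.v ϖE ^ jl * Valued.v (α - ρ α))
    {J : ℕ} (hJ : ¬ IsOrd ρ α (ϖE ^ (J + 1)) lam) (F : ℕ → N) :
    ∑ j ∈ Finset.range (J + 1), (if IsOrd ρ α (ϖE ^ j) lam then F j else 0) = ∑ j ∈ Finset.range (jl + 1), F j := by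
  have hiff := isOrd_pow_iff_le hα hϖ0 hϖ1 hlam1 hjl
  refine sum_range_ite_isOrd_eq_sum_range hiff ?_ F
  by_contra hlt
  exact hJ ((hiff (J + 1)).2 (by omega))

end Summit.HodgeConjecture.HodgeConjecture.Cruxes.H413.F0P3cDyRamOrderFiltrationRange

end
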